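import Literature.AlgebraicGeometry.Motives.GoodReductionSpecialFibreProofs
import Literature.AlgebraicGeometry.Resolution.SmoothStalksRegular
import HarnessLib

/-!
# Affine irreducible open neighbourhoods in schemes with integral local rings

Topic: `Literature/AlgebraicGeometry/Morphisms`. On a locally Noetherian scheme `X`, a point `x`
whose local ring `𝒪_{X,x}` is a domain lies on exactly one irreducible component, and the
irreducible components through such points are open (EGA I (1971), Chap. I, Cor. 6.1.9–6.1.10;
The Stacks Project, Tags 033N, 0357: a locally Noetherian normal scheme — more generally one whose
local rings are domains — is the disjoint union of its integral components). Hence `x` has an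
**affine irreducible open neighbourhood**: shrink the irreducible open neighbourhood of the tree's
`Literature.AlgebraicGeometry.Motives.exists_isOpen_isIrreducible_of_isDomain_stalk`
(Görtz–Wedhorn I, Exercise 3.16) to an affine open (the affine opens form a basis,
`AlgebraicGeometry.exists_isAffineOpen_mem_and_subset`); a non-empty open subset of an irreducible
set is irreducible (`IsPreirreducible.open_subset`). Everything here is PROVED:

* `exists_isAffineOpen_irreducibleSpace_of_isDomain_stalk` — the statement above;
* `exists_isAffineOpen_irreducibleSpace_of_smooth` — for `X` smooth over a field `k` (its local
  rings are regular, hence domains: Stacks Tag 056S,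
  `Literature.AlgebraicGeometry.Resolution.isDomain_stalk_of_smooth`; and `X` is locally
  Noetherian, being locally of finite type over `k`);
* `exists_isAffineOpen_irreducibleSpace_schemeOver`, `exists_opens_isAffine_irreducibleSpace_smooth`
  — the same for a `k`-scheme `X : SchemeOver k = Over (Spec k)` with smooth structure map, the
  second packaging the open `U ∋ x` as the `k`-scheme `Over.mk (U.ι ≫ X.hom)` (which is, by `rfl`,
  the tree's `Motives.openSubschemeOver X U` over `ℂ` and `Motives.OpenGraph.openOver X U`) with
  `IsAffine`, `IrreducibleSpace` underlying scheme and `Smooth` structure map — the form in which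
  arguments over a smooth base are localised to smooth affine irreducible bases.

## References

* A. Grothendieck, J. Dieudonné, *EGA I* (Springer 1971), Chap. I, §2.1 (affine opens form a
  basis) and Cor. 6.1.9–6.1.10 (components of locally Noetherian schemes). [folklore]
* [StacksProject] The Stacks Project, Tag 033N (normal schemes with locally finitely many
  components are disjoint unions of integral schemes), Tag 0357 (locally Noetherian case),
  Tag 056S (smooth over a field implies regular). [folklore]
* [GortzWedhorn2020] U. Görtz, T. Wedhorn, *Algebraic Geometry I*, 2nd ed. (2020), Exercise 3.16
  (p. 117). [folklore]
-/

universe u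

open CategoryTheory AlgebraicGeometry TopologicalSpace

namespace Literature.AlgebraicGeometry.Morphisms

/-! ### Locally Noetherian schemes with an integral local ring -/

/-- **Affine irreducible neighbourhoods.** On a locally Noetherian scheme, a point `x` whose local
ring `𝒪_{X,x}` is a domain has an affine open neighbourhood `U` which is irreducible (EGA I, Cor.
6.1.9–6.1.10; Stacks Tags 033N, 0357; Görtz–Wedhorn I, Exercise 3.16): an affine open
neighbourhood inside the irreducible open neighbourhood
`Motives.exists_isOpen_isIrreducible_of_isDomain_stalk` is a non-empty open subset of an
irreducible set. [folklore] -/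
theorem exists_isAffineOpen_irreducibleSpace_of_isDomain_stalk (X : Scheme.{u})
    [IsLocallyNoetherian X] (x : X) [IsDomain (X.presheaf.stalk x)] :
    ∃ U : X.Opens, IsAffineOpen U ∧ x ∈ (U : Set X) ∧ IrreducibleSpace U := by
  obtain ⟨W, hWo, hxW, hWirr⟩ :=
    Literature.AlgebraicGeometry.Motives.exists_isOpen_isIrreducible_of_isDomain_stalk X x
  obtain ⟨U, hU, hxU, hUW⟩ :=
    exists_isAffineOpen_mem_and_subset (U := ⟨W, hWo⟩) (show x ∈ (⟨W, hWo⟩ : X.Opens) from hxW)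
  exact ⟨U, hU, hxU, Subtype.irreducibleSpace ⟨⟨x, hxU⟩, hWirr.2.open_subset U.2 hUW⟩⟩

/-! ### Schemes smooth over a field -/

section Smooth

variable {k : Type u} [Field k]

/-- **Affine irreducible neighbourhoods on a smooth scheme over a field.** If `f : X → Spec k` is
smooth (`k` a field), every point `x ∈ X` has an affine irreducible open neighbourhood: `X` is
locally Noetherian (locally of finite type over a field) and its local rings are regular, hence
domains (Stacks Tag 056S, `Resolution.isDomain_stalk_of_smooth`), so
`exists_isAffineOpen_irreducibleSpace_of_isDomain_stalk` applies. [folklore] -/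
theorem exists_isAffineOpen_irreducibleSpace_of_smooth {X : Scheme.{u}}
    (f : X ⟶ Spec (CommRingCat.of k)) [Smooth f] (x : X) :
    ∃ U : X.Opens, IsAffineOpen U ∧ x ∈ (U : Set X) ∧ IrreducibleSpace U := by
  haveI : IsLocallyNoetherian X := LocallyOfFiniteType.isLocallyNoetherian f
  haveI := Literature.AlgebraicGeometry.Resolution.isDomain_stalk_of_smooth f x
  exact exists_isAffineOpen_irreducibleSpace_of_isDomain_stalk X x

open Literature.AlgebraicGeometry.Motives (SchemeOver)

/-- **Affine irreducible neighbourhoods on a smooth `k`-scheme** (`SchemeOver` form): for a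
`k`-scheme `X` with smooth structure map `X.hom : X.left → Spec k`, every point of `X.left` has an
affine irreducible open neighbourhood (`exists_isAffineOpen_irreducibleSpace_of_smooth`).
[folklore] -/
theorem exists_isAffineOpen_irreducibleSpace_schemeOver (X : SchemeOver k) [Smooth X.hom]
    (x : X.left) :
    ∃ U : X.left.Opens, IsAffineOpen U ∧ x ∈ (U : Set X.left) ∧ IrreducibleSpace U :=
  exists_isAffineOpen_irreducibleSpace_of_smooth X.hom x

/-- **Localising to a smooth affine irreducible base.** For a `k`-scheme `X` with smooth structure
map and a point `x ∈ X.left`, there is an open `U ∋ x` such that the open subscheme `U`, as a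
`k`-scheme `Over.mk (U.ι ≫ X.hom)` (by `rfl` the tree's `Motives.openSubschemeOver X U` over `ℂ`,
and `Motives.OpenGraph.openOver X U`), has affine irreducible underlying scheme and smooth
structure map `U ↪ X → Spec k` (an open immersion followed by a smooth morphism). [folklore] -/
theorem exists_opens_isAffine_irreducibleSpace_smooth (X : SchemeOver k) [Smooth X.hom]
    (x : X.left) :
    ∃ U : X.left.Opens, x ∈ U ∧ IsAffine (Over.mk (U.ι ≫ X.hom) : SchemeOver k).left ∧
      IrreducibleSpace ↥(Over.mk (U.ι ≫ X.hom) : SchemeOver k).left ∧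
      Smooth (Over.mk (U.ι ≫ X.hom) : SchemeOver k).hom := by
  obtain ⟨U, hU, hxU, hUirr⟩ := exists_isAffineOpen_irreducibleSpace_of_smooth X.hom x
  exact ⟨U, hxU, hU, hUirr, inferInstanceAs (Smooth (U.ι ≫ X.hom))⟩

end Smooth

end Literature.AlgebraicGeometry.Morphisms
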